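import Literature.NumberTheory.Automorphic.ShimuraCurveFiniteVolume
import Literature.NumberTheory.Automorphic.ShimuraCurveUnitGroupTraces
import Literature.NumberTheory.Automorphic.ShimuraCurveMinimalDegreeIsogenyBoundProofs
import HarnessLib

/-!
# `S₂^D(M)` is a Hecke module for `D > 1`: the operators `T_n` of a Shimura curve datum are
# endomorphisms of `CuspForm X.Gamma 2`

A proofs-only companion (theorems only: no definition, no named fact, nothing restated; D-0026) of
`ShimuraCurve.lean` / `ShimuraCurveRibetTakahashi.lean`, written by the seat of the named fact
`Literature.NumberTheory.Automorphic.nonempty_shimuraParametrizationData` (Pasten 2024, §2 p. 12: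
the Jacquet–Langlands parametrisation `X₀^D(M) → A_{D,M} ∼ E`). That fact is reduced in the tree
(`ShimuraCurveJacquetLanglandsReductionProofs`) to the Modularity theorem together with, for
`D > 1`, (T) the Jacquet–Langlands transfer of a newform to a `T_ℓ`-eigenform in `S₂(X.Gamma)`
and (S) the Eichler–Shimura construction on `X₀^D(M)`; both are statements about the Hecke
operators `T_{D,M,n}` acting on the space `S₂^D(M)` of weight-`2` forms for `Γ₀^D(M) = ι(O¹)`
(Pasten §4.6, §4.8–4.9). The tree's `ShimuraCurveData.heckeFun n` is that operator on bare
functions `ℍ → ℂ` (a `finsum` over `Quotient.out` representatives of `Γ \ ι(O(n))`). This file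
proves, for `D > 1`, that it is an honest `ℂ`-linear endomorphism of Mathlib's
`CuspForm X.Gamma 2` — the first brick of any formalisation of (T)/(S):

* `ShimuraCurveData.not_isParabolic_of_mem_Gamma`, `ShimuraCurveData.not_isCusp_of_one_lt` —
  **`Γ₀^D(M)` has no parabolic elements and no cusps for `D > 1`** (Pasten §4.3 p. 14: "where the
  cusps are only needed if `D = 1`"; §4.6 p. 15: "the cuspidal condition is only needed when
  `D = 1`"): a parabolic `γ ∈ Γ` has `tr(γ)² = 4 det γ = 4`, hence `γ = ±1` by the tree's
  `eq_one_or_eq_neg_one_of_sq_trace_eq_four` (`B` a division algebra), which is scalar;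
* `ShimuraCurveData.mul_mem_heckeSet`, `ShimuraCurveData.heckeSet_pos`,
  `ShimuraCurveData.isEmpty_heckeSet_zero` — `ι(O(n)) Γ ⊆ ι(O(n))`, and `ι(O(n)) ≠ ∅ ⇒ n > 0`;
* `ShimuraCurveData.finite_quotient_heckeSetoid` — **`Γ \ ι(O(n))` is finite** (`D > 1`): by the
  tree's `exists_finite_reps` (Vignéras IV §1: finitely many elements of `O` of reduced norm `n` up
  to left units of norm `1`), every coset is that of `ι(r)` for `r` in a finite set;
* `ShimuraCurveData.heckeFun_eq_sum` — with a `Fintype` structure on the coset space,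
  `T_n h = ∑_q h ∣[2] q.out` as functions;
* `ShimuraCurveData.heckeFun_slash_eq` — **`(T_n h) ∣[2] γ = T_n h` for `γ ∈ Γ`** and `h`
  `Γ`-invariant of weight `2`: right multiplication by `γ` permutes `Γ \ ι(O(n))`, and
  `h ∣ (δ a) = h ∣ a` for `δ ∈ Γ`;
* `ShimuraCurveData.mdifferentiable_heckeFun` — `T_n h` is holomorphic for `h` holomorphic
  (Mathlib `MDifferentiable.slash`, finite sum);
* `ShimuraCurveData.heckeFun_add`, `ShimuraCurveData.heckeFun_smul`, `ShimuraCurveData.heckeFun_zero`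
  — linearity on functions (all `n`; the tree's `heckeFun_const_smul` needs `n > 0`, and `T_0 = 0`
  as `ι(O(0)) ∩ GL₂(ℝ) = ∅`);
* `ShimuraCurveData.exists_cuspForm_coe_eq_heckeFun` — **for `D > 1` and `g ∈ S₂(X.Gamma)`,
  `T_n g ∈ S₂(X.Gamma)`**: some `CuspForm X.Gamma 2` has underlying function `X.heckeFun n g`
  (slash-invariance, holomorphy, and the cusp condition is vacuous);
* `ShimuraCurveData.exists_linearMap_coe_eq_heckeFun` — **`T_{D,M,n} ∈ End_ℂ(S₂^D(M))`**
  (Pasten §4.8 p. 15: the Hecke correspondences act "by endomorphisms on `H⁰(X_U, Ω¹)`" `≅ S_U`,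
  §4.6): a `ℂ`-linear `T : CuspForm X.Gamma 2 →ₗ[ℂ] CuspForm X.Gamma 2` with `⇑(T g) = X.heckeFun n g`
  for every `g` — stated as an existence theorem so that this file introduces no definition; a
  definitional `heckeOp` may later be obtained from it by choice, uniquely (`DFunLike` injectivity,
  `ShimuraCurveData.linearMap_coe_eq_heckeFun_unique`).

Nothing here is specific to `n` coprime to `D M`; commutativity, normality for the Petersson
product and multiplicity one (Pasten §4.9) are not addressed.

## References

* H. Pasten, *Shimura curves and the abc conjecture*, J. Number Theory 254 (2024) 214–335 =
  arXiv:1705.09251 (held, read): §4.3 p. 14, §4.6 p. 15, §4.8 p. 15. [PastenShimura2024]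
* M.-F. Vignéras, *Arithmétique des algèbres de quaternions*, LNM 800 (1980), Ch. IV §1
  Thm. 1.1. [VignerasLNM800]
* G. Shimura, *Introduction to the arithmetic theory of automorphic functions* (1971), §3.3
  (double cosets `Γ α Γ` and the operators they define). [ShimuraIATAF1971]
-/

noncomputable section

open scoped MatrixGroups ModularForm Manifold
open UpperHalfPlane

namespace Literature.NumberTheory.Automorphic

namespace ShimuraCurveData

variable {D M : ℕ} (X : ShimuraCurveData D M)

/-! ### 1. No parabolic elements, no cusps (`D > 1`) -/

/-- **`Γ₀^D(M)` has no parabolic elements for `D > 1`.** A parabolic `γ ∈ Γ` has discriminant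
`tr(γ)² − 4 det(γ) = 0` and `det γ = 1`, so `tr(γ)² = 4` and `γ = ±1`
(`eq_one_or_eq_neg_one_of_sq_trace_eq_four`: `B` is a division algebra), a scalar — but parabolic
elements are non-scalar by definition. [cite: PastenShimura2024, §4.3 p. 14 ("the cusps are only needed if D = 1")] -/
theorem not_isParabolic_of_mem_Gamma (hD : 1 < D) {γ : GL (Fin 2) ℝ} (hγ : γ ∈ X.Gamma) :
    ¬ γ.IsParabolic := by
  rintro ⟨hns, hdisc⟩
  have hdet := X.det_coe_eq_one hγ
  rw [Matrix.discr_fin_two, hdet] at hdisc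
  have ht : (γ : Matrix (Fin 2) (Fin 2) ℝ).trace ^ 2 = 4 := by linear_combination hdisc
  rcases X.eq_one_or_eq_neg_one_of_sq_trace_eq_four hD hγ ht with rfl | rfl
  · exact hns ⟨1, by simp⟩
  · exact hns ⟨-1, by rw [map_neg, map_one, Units.val_neg, Units.val_one]⟩

/-- **`X₀^D(M)` has no cusps for `D > 1`** (Mathlib `IsCusp c Γ`: `c` is fixed by a parabolic
element of `Γ`): so the cusp conditions of `ModularForm X.Gamma k` / `CuspForm X.Gamma k` are
vacuous, as in Pasten §4.6 p. 15 ("the cuspidal condition is only needed when `D = 1`").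
[cite: PastenShimura2024, §4.3 p. 14 and §4.6 p. 15] -/
theorem not_isCusp_of_one_lt (hD : 1 < D) (c : OnePoint ℝ) : ¬ IsCusp c X.Gamma := by
  rintro ⟨γ, hγ, hpar, -⟩
  exact X.not_isParabolic_of_mem_Gamma hD hγ hpar

/-! ### 2. The coset space `Γ \ ι(O(n))` -/

/-- `ι(O(n)) · Γ ⊆ ι(O(n))`: `ι(x) ι(u) = ι(x u)` with `x u ∈ O` and `det = n · 1`. [folklore] -/
theorem mul_mem_heckeSet {n : ℕ} {a γ : GL (Fin 2) ℝ} (ha : a ∈ X.heckeSet n) (hγ : γ ∈ X.Gamma) :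
    a * γ ∈ X.heckeSet n := by
  obtain ⟨⟨x, hx, hxa⟩, hdet⟩ := ha
  obtain ⟨⟨u, hu, huγ⟩, -, hdetγ⟩ := hγ
  refine ⟨⟨x * u, X.isOrder.mul_mem _ hx _ hu, by rw [map_mul, hxa, huγ, Units.val_mul]⟩, ?_⟩
  rw [Units.val_mul, Matrix.det_mul, hdet, ← Matrix.GeneralLinearGroup.val_det_apply, hdetγ,
    Units.val_one, mul_one]

/-- `Γ · ι(O(n)) ⊆ ι(O(n))`. [folklore] -/
theorem mul_mem_heckeSet' {n : ℕ} {a γ : GL (Fin 2) ℝ} (hγ : γ ∈ X.Gamma) (ha : a ∈ X.heckeSet n) :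
    γ * a ∈ X.heckeSet n := by
  obtain ⟨⟨x, hx, hxa⟩, hdet⟩ := ha
  obtain ⟨⟨u, hu, huγ⟩, -, hdetγ⟩ := hγ
  refine ⟨⟨u * x, X.isOrder.mul_mem _ hu _ hx, by rw [map_mul, hxa, huγ, Units.val_mul]⟩, ?_⟩
  rw [Units.val_mul, Matrix.det_mul, hdet, ← Matrix.GeneralLinearGroup.val_det_apply, hdetγ,
    Units.val_one, one_mul]

/-- If `ι(O(n))` has an element then `n > 0` (`det ≠ 0` on `GL₂(ℝ)`, and `det = n`). [folklore] -/
theorem heckeSet_pos {n : ℕ} {a : GL (Fin 2) ℝ} (ha : a ∈ X.heckeSet n) : 0 < n := by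
  rcases Nat.eq_zero_or_pos n with rfl | h
  · exfalso
    have h0 : (a : Matrix (Fin 2) (Fin 2) ℝ).det = 0 := by rw [ha.2, Nat.cast_zero]
    rw [← Matrix.GeneralLinearGroup.val_det_apply] at h0
    exact a.det.ne_zero h0
  · exact h

/-- `ι(O(0)) = ∅` in `GL₂(ℝ)`. [folklore] -/
theorem isEmpty_heckeSet_zero : IsEmpty (X.heckeSet 0) :=
  ⟨fun a => absurd (X.heckeSet_pos a.2) (lt_irrefl 0)⟩

/-- An element of `Γ` as the matrix `ι(u)` packaged in `GL₂(ℝ)`: for `u, u' ∈ O` with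
`u' u = 1` and `nrd u = 1`, the matrix `ι(u)` is invertible and lies in `Γ`. [folklore] -/
theorem exists_mem_Gamma_coe_eq_ι {u u' : X.B} (hu : u ∈ X.O) (hu' : u' ∈ X.O)
    (hu'u : u' * u = 1) (hN : nrdZ u = 1) :
    ∃ γ ∈ X.Gamma, (γ : Matrix (Fin 2) (Fin 2) ℝ) = X.ι u := by
  have hZ := X.isZOrder
  have hdet1 : (X.ι u).det = 1 := by
    rw [(X.trace_ι_eq_and_det_ι_eq u).2, ← hZ.cast_nrdZ hu, hN]; push_cast; rfl
  set γ : GL (Fin 2) ℝ := Matrix.GeneralLinearGroup.mkOfDetNeZero (X.ι u)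
    (by rw [hdet1]; exact one_ne_zero) with hγ
  have hγval : (γ : Matrix (Fin 2) (Fin 2) ℝ) = X.ι u := rfl
  have hγinv : ((γ⁻¹ : GL (Fin 2) ℝ) : Matrix (Fin 2) (Fin 2) ℝ) = X.ι u' := by
    rw [Matrix.coe_units_inv, hγval]
    exact Matrix.inv_eq_left_inv (by rw [← map_mul, hu'u, map_one])
  refine ⟨γ, ⟨⟨u, hu, hγval.symm⟩, ⟨u', hu', hγinv.symm⟩, ?_⟩, hγval⟩
  ext
  rw [Matrix.GeneralLinearGroup.val_det_apply, hγval, hdet1, Units.val_one]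

/-- **`Γ \ ι(O(n))` is finite for `D > 1`.** Every `a ∈ ι(O(n))` is `ι(x)` with `x ∈ O`,
`nrd x = n`; by the tree's `exists_finite_reps` (Vignéras IV §1, proof of Thm. 1.1), `x = u r`
with `r` in a fixed finite set `T ⊆ O` and `u ∈ O¹`, so the coset `Γ a = Γ ι(r)`; cosets with the
same `r` coincide. (For `n = 0` the set is empty.) This is the finiteness of the number of integral
left `O`-ideals of norm `n` invoked in the docstring of `ShimuraCurveData.heckeFun`.
[cite: VignerasLNM800, Ch. IV §1 Thm. 1.1 (proof)] -/
theorem finite_quotient_heckeSetoid (hD : 1 < D) (n : ℕ) :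
    Finite (Quotient (X.heckeSetoid n)) := by
  classical
  have hZ := X.isZOrder
  obtain ⟨T, hTfin, -, hT⟩ := X.exists_finite_reps hD n
  haveI : Finite T := hTfin.to_subtype
  -- every class is the class of `ι(r)`, `r ∈ T`
  have key : ∀ q : Quotient (X.heckeSetoid n), ∃ r ∈ T, ∃ γ ∈ X.Gamma,
      (((q.out : X.heckeSet n) : GL (Fin 2) ℝ) : Matrix (Fin 2) (Fin 2) ℝ) =
        (γ : Matrix (Fin 2) (Fin 2) ℝ) * X.ι r := by
    intro q
    obtain ⟨⟨x, hx, hxq⟩, hdet⟩ := (q.out : X.heckeSet n).2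
    have hx0 : x ≠ 0 := by
      rintro rfl
      rw [map_zero] at hxq
      have h0 : (((q.out : X.heckeSet n) : GL (Fin 2) ℝ) : Matrix (Fin 2) (Fin 2) ℝ).det = 0 := by
        rw [← hxq, Matrix.det_zero]
      rw [← Matrix.GeneralLinearGroup.val_det_apply] at h0
      exact ((q.out : X.heckeSet n) : GL (Fin 2) ℝ).det.ne_zero h0
    have hnrd : nrdZ x = n := by
      have h1 : ((nrdZ x : ℚ) : ℝ) = (n : ℝ) := by
        rw [hZ.cast_nrdZ hx, ← (X.trace_ι_eq_and_det_ι_eq x).2, hxq, hdet]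
      exact_mod_cast h1
    obtain ⟨r, hr, u, hu, u', hu', -, hu'u, hNu, hxur⟩ :=
      hT x hx hx0 (by rw [hnrd, Int.natAbs_natCast])
    obtain ⟨γ, hγ, hγu⟩ := X.exists_mem_Gamma_coe_eq_ι hu hu' hu'u hNu
    exact ⟨r, hr, γ, hγ, by rw [← hxq, hxur, map_mul, hγu]⟩
  choose f hfT hf using key
  refine Finite.of_injective (fun q => (⟨f q, hfT q⟩ : T)) fun q₁ q₂ h => ?_
  simp only [Subtype.mk.injEq] at h
  obtain ⟨γ₁, hγ₁, h₁⟩ := hf q₁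
  obtain ⟨γ₂, hγ₂, h₂⟩ := hf q₂
  rw [h] at h₁
  have hGL : (γ₂ * γ₁⁻¹) * ((q₁.out : X.heckeSet n) : GL (Fin 2) ℝ) =
      ((q₂.out : X.heckeSet n) : GL (Fin 2) ℝ) := by
    refine Units.ext ?_
    rw [Units.val_mul, Units.val_mul, h₁, h₂, ← mul_assoc, mul_assoc (γ₂ : Matrix (Fin 2) (Fin 2) ℝ),
      ← Units.val_mul, inv_mul_cancel, Units.val_one, mul_one]
  calc q₁ = Quotient.mk _ q₁.out := (Quotient.out_eq q₁).symm
    _ = Quotient.mk _ q₂.out := Quotient.sound ⟨γ₂ * γ₁⁻¹, mul_mem hγ₂ (inv_mem hγ₁), hGL⟩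
    _ = q₂ := Quotient.out_eq q₂

/-! ### 3. `T_n` as a finite sum; invariance; holomorphy; linearity -/

/-- With a `Fintype` structure on `Γ \ ι(O(n))`, `T_n h = ∑_q h ∣[2] q.out` as functions on `ℍ`.
[folklore] -/
theorem heckeFun_eq_sum (n : ℕ) [Fintype (Quotient (X.heckeSetoid n))] (h : ℍ → ℂ) :
    X.heckeFun n h =
      ∑ q : Quotient (X.heckeSetoid n), (h ∣[(2 : ℤ)] ((q.out : X.heckeSet n) : GL (Fin 2) ℝ)) := by
  funext τ
  simp only [ShimuraCurveData.heckeFun, finsum_eq_sum_of_fintype, Finset.sum_apply]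

/-- **`Γ`-invariance of `T_n h`**: if `h ∣[2] δ = h` for all `δ ∈ Γ`, then `(T_n h) ∣[2] γ = T_n h`
for `γ ∈ Γ` (`D > 1`, so that the coset space is finite and the `finsum` is a sum). Right
multiplication by `γ` permutes the cosets `Γ \ ι(O(n))`; the representative of the image coset
differs from `q.out γ` by an element of `Γ` on the left, which `h` absorbs.
[cite: ShimuraIATAF1971, §3.3] -/
theorem heckeFun_slash_eq (hD : 1 < D) (n : ℕ) {γ : GL (Fin 2) ℝ} (hγ : γ ∈ X.Gamma) (h : ℍ → ℂ)
    (hh : ∀ δ ∈ X.Gamma, h ∣[(2 : ℤ)] δ = h) :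
    (X.heckeFun n h) ∣[(2 : ℤ)] γ = X.heckeFun n h := by
  classical
  haveI := X.finite_quotient_heckeSetoid hD n
  letI : Fintype (Quotient (X.heckeSetoid n)) := Fintype.ofFinite _
  -- right translations by `γ` and `γ⁻¹` on `ι(O(n))` and on the coset space
  let ρ : X.heckeSet n → X.heckeSet n := fun a => ⟨a * γ, X.mul_mem_heckeSet a.2 hγ⟩
  let ρ' : X.heckeSet n → X.heckeSet n := fun a => ⟨a * γ⁻¹, X.mul_mem_heckeSet a.2 (inv_mem hγ)⟩
  have hρ : ∀ a b : X.heckeSet n, (X.heckeSetoid n) a b → (X.heckeSetoid n) (ρ a) (ρ b) := by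
    rintro a b ⟨δ, hδ, hab⟩
    exact ⟨δ, hδ, by simp only [ρ, ← mul_assoc, hab]⟩
  have hρ' : ∀ a b : X.heckeSet n, (X.heckeSetoid n) a b → (X.heckeSetoid n) (ρ' a) (ρ' b) := by
    rintro a b ⟨δ, hδ, hab⟩
    exact ⟨δ, hδ, by simp only [ρ', ← mul_assoc, hab]⟩
  let e : Quotient (X.heckeSetoid n) ≃ Quotient (X.heckeSetoid n) :=
    { toFun := Quotient.map ρ hρ
      invFun := Quotient.map ρ' hρ'
      left_inv := fun q => Quotient.inductionOn q fun a => by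
        simp only [Quotient.map_mk]
        refine congrArg _ (Subtype.ext ?_)
        simp only [ρ, ρ', mul_inv_cancel_right]
      right_inv := fun q => Quotient.inductionOn q fun a => by
        simp only [Quotient.map_mk]
        refine congrArg _ (Subtype.ext ?_)
        simp only [ρ, ρ', inv_mul_cancel_right] }
  have he : ∀ q, e q = Quotient.map ρ hρ q := fun q => rfl
  -- termwise
  have hterm : ∀ q : Quotient (X.heckeSetoid n),
      (h ∣[(2 : ℤ)] ((q.out : X.heckeSet n) : GL (Fin 2) ℝ)) ∣[(2 : ℤ)] γ =
        h ∣[(2 : ℤ)] (((e q).out : X.heckeSet n) : GL (Fin 2) ℝ) := by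
    intro q
    rw [← SlashAction.slash_mul]
    have h1 : e q = Quotient.mk _ (ρ q.out) := by
      conv_lhs => rw [he, ← Quotient.out_eq q]
      rfl
    have h2 : (X.heckeSetoid n) (e q).out (ρ q.out) :=
      Quotient.exact (((e q).out_eq).trans h1)
    obtain ⟨δ, hδ, hδeq⟩ := h2
    have h3 : ((q.out : X.heckeSet n) : GL (Fin 2) ℝ) * γ =
        δ * (((e q).out : X.heckeSet n) : GL (Fin 2) ℝ) := hδeq.symm
    rw [h3, SlashAction.slash_mul, hh δ hδ]
  rw [X.heckeFun_eq_sum, SlashAction.sum_slash]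
  simp_rw [hterm]
  exact Equiv.sum_comp e (fun q => h ∣[(2 : ℤ)] ((q.out : X.heckeSet n) : GL (Fin 2) ℝ))

/-- **`T_n h` is holomorphic** for holomorphic `h` (`D > 1`): a finite sum of slashes
(Mathlib `MDifferentiable.slash`). [folklore] -/
theorem mdifferentiable_heckeFun (hD : 1 < D) (n : ℕ) {h : ℍ → ℂ}
    (hh : MDifferentiable 𝓘(ℂ) 𝓘(ℂ) h) : MDifferentiable 𝓘(ℂ) 𝓘(ℂ) (X.heckeFun n h) := by
  classical
  haveI := X.finite_quotient_heckeSetoid hD n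
  letI : Fintype (Quotient (X.heckeSetoid n)) := Fintype.ofFinite _
  rw [X.heckeFun_eq_sum]
  exact MDifferentiable.sum fun q _ => hh.slash 2 _

/-- `T_n (h₁ + h₂) = T_n h₁ + T_n h₂` (`D > 1`). [folklore] -/
theorem heckeFun_add (hD : 1 < D) (n : ℕ) (h₁ h₂ : ℍ → ℂ) :
    X.heckeFun n (h₁ + h₂) = X.heckeFun n h₁ + X.heckeFun n h₂ := by
  classical
  haveI := X.finite_quotient_heckeSetoid hD n
  letI : Fintype (Quotient (X.heckeSetoid n)) := Fintype.ofFinite _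
  simp only [X.heckeFun_eq_sum, SlashAction.add_slash, Finset.sum_add_distrib]

/-- `T_0 = 0` (the index set `Γ \ ι(O(0))` is empty). [folklore] -/
theorem heckeFun_zero_left (h : ℍ → ℂ) : X.heckeFun 0 h = 0 := by
  haveI := X.isEmpty_heckeSet_zero
  funext τ
  simp only [ShimuraCurveData.heckeFun, Pi.zero_apply]
  haveI : IsEmpty (Quotient (X.heckeSetoid 0)) :=
    ⟨fun q => IsEmpty.false (q.out : X.heckeSet 0)⟩
  exact finsum_of_isEmpty _

/-- `T_n (c • h) = c • T_n h` for every `n` (the tree's `heckeFun_const_smul` for `n > 0`;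
`T_0 = 0`). [folklore] -/
theorem heckeFun_smul (n : ℕ) (c : ℂ) (h : ℍ → ℂ) :
    X.heckeFun n (c • h) = c • X.heckeFun n h := by
  rcases Nat.eq_zero_or_pos n with rfl | hn
  · rw [X.heckeFun_zero_left, X.heckeFun_zero_left, smul_zero]
  · exact X.heckeFun_const_smul hn c h

/-- `T_n 0 = 0`. [folklore] -/
theorem heckeFun_zero (n : ℕ) : X.heckeFun n (0 : ℍ → ℂ) = 0 := by
  have := X.heckeFun_smul n 0 0
  rwa [zero_smul, zero_smul] at this

/-! ### 4. `T_n` on `S₂^D(M) = CuspForm X.Gamma 2` (`D > 1`) -/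

/-- **`T_n` preserves `S₂^D(M)` (`D > 1`)**: for `g ∈ S₂(X.Gamma)` there is a cusp form with
underlying function `T_n g` — `Γ`-invariant (`heckeFun_slash_eq`), holomorphic
(`mdifferentiable_heckeFun`), and the cusp condition is vacuous (`not_isCusp_of_one_lt`). This is
the action of `T_{U,n}` on `S_U ≅ H⁰(X_U, Ω¹)` of Pasten §4.8 for `U = U₀^D(M)`.
[cite: PastenShimura2024, §4.8 p. 15 (Hecke action) with §4.6 p. 15] -/
theorem exists_cuspForm_coe_eq_heckeFun (hD : 1 < D) (n : ℕ) (g : CuspForm X.Gamma 2) :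
    ∃ T : CuspForm X.Gamma 2, (⇑T : ℍ → ℂ) = X.heckeFun n g :=
  ⟨{ toFun := X.heckeFun n g
     slash_action_eq' := fun _ hγ =>
       X.heckeFun_slash_eq hD n hγ g fun δ hδ => SlashInvariantForm.slash_action_eqn g δ hδ
     holo' := X.mdifferentiable_heckeFun hD n g.holo'
     zero_at_cusps' := fun hc => absurd hc (X.not_isCusp_of_one_lt hD _) }, rfl⟩

/-- **`T_{D,M,n} ∈ End_ℂ(S₂^D(M))` for `D > 1`**: there is a `ℂ`-linear endomorphism `T` of
`CuspForm X.Gamma 2` with `⇑(T g) = X.heckeFun n g` for all `g` (Pasten §4.8 p. 15: the Hecke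
correspondences act "by endomorphisms on `H⁰(X_U, Ω¹)`", `≅ S_U` by §4.6). Existence form (no
definition is introduced here); `T` is unique, `linearMap_coe_eq_heckeFun_unique`.
[cite: PastenShimura2024, §4.8 p. 15 (Hecke action) with §4.6 p. 15] -/
theorem exists_linearMap_coe_eq_heckeFun (hD : 1 < D) (n : ℕ) :
    ∃ T : CuspForm X.Gamma 2 →ₗ[ℂ] CuspForm X.Gamma 2,
      ∀ g : CuspForm X.Gamma 2, (⇑(T g) : ℍ → ℂ) = X.heckeFun n g := by
  choose T hT using X.exists_cuspForm_coe_eq_heckeFun hD n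
  refine ⟨{ toFun := T, map_add' := fun g₁ g₂ => ?_, map_smul' := fun c g => ?_ }, hT⟩
  · apply DFunLike.coe_injective
    rw [hT, CuspForm.coe_add, CuspForm.coe_add, hT, hT, X.heckeFun_add hD]
  · apply DFunLike.coe_injective
    rw [hT, RingHom.id_apply, CuspForm.IsGLPos.coe_smul, CuspForm.IsGLPos.coe_smul, hT,
      X.heckeFun_smul]

/-- Uniqueness of the endomorphism `T_n` of `S₂^D(M)` with `⇑(T g) = X.heckeFun n g`. [folklore] -/
theorem linearMap_coe_eq_heckeFun_unique (n : ℕ)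
    {T T' : CuspForm X.Gamma 2 →ₗ[ℂ] CuspForm X.Gamma 2}
    (hT : ∀ g : CuspForm X.Gamma 2, (⇑(T g) : ℍ → ℂ) = X.heckeFun n g)
    (hT' : ∀ g : CuspForm X.Gamma 2, (⇑(T' g) : ℍ → ℂ) = X.heckeFun n g) : T = T' :=
  LinearMap.ext fun g => DFunLike.coe_injective ((hT g).trans (hT' g).symm)

/-- **Eigenforms in `S₂^D(M)`**: for `D > 1`, a cusp form `g` with `T_ℓ g = a · g` as functions is an
eigenvector of the endomorphism `T_ℓ` of `S₂^D(M)` — the form in which the Hecke condition of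
`ShimuraParametrizationData.hecke_eq` and the hypotheses (T), (S) of
`nonempty_shimuraParametrizationData_of_exists_isNewformOf_of_transfer_of_construction` are read
as statements about the Hecke module `S₂^D(M)` (Pasten §4.9). [cite: PastenShimura2024, §4.8–4.9 pp. 15–16] -/
theorem linearMap_apply_eq_smul_of_heckeFun_eq (n : ℕ)
    {T : CuspForm X.Gamma 2 →ₗ[ℂ] CuspForm X.Gamma 2}
    (hT : ∀ g : CuspForm X.Gamma 2, (⇑(T g) : ℍ → ℂ) = X.heckeFun n g)
    {g : CuspForm X.Gamma 2} {a : ℂ} (hg : X.heckeFun n g = fun τ => a * g τ) :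
    T g = a • g := by
  apply DFunLike.coe_injective
  rw [hT, hg, CuspForm.IsGLPos.coe_smul]
  funext τ
  simp only [Pi.smul_apply, smul_eq_mul]

end ShimuraCurveData

end Literature.NumberTheory.Automorphic

end
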